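import Literature.NumberTheory.LFunctions.VanDerCorputZeta
import Mathlib.Analysis.InnerProductSpace.Basic
import HarnessLib

/-!
# Tao's circle-method estimate (Tao 2016, Lemma 3.6) and the fourth-moment count of large frequencies

Topic `Literature/NumberTheory/LFunctions`. Everything in this file is PROVED (no named facts).

This is the deterministic Fourier-analytic input to the proof of the Liouville case of Tao's
Theorem 2.3 (Tao 2016, §3): the circle-method estimate Lemma 3.6 (with `c_p = 1`, the
Liouville/Erdős-discrepancy case singled out after Proposition 2.6 of the paper) in a fully
explicit form, and the first half of Lemma 3.7 ("restriction theorem for the primes"): the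
number of large frequencies `Ξ_H` is controlled by the fourth moment of the prime exponential
sum `S_H`, i.e. by the number of additive quadruples `p₁ + p₂ = p₃ + p₄` in `𝒫_H` (the route of
the footnote to the proof of Lemma 3.7; the sieve bound for that count is proved elsewhere).

## Content (namespace `Literature.Tao2016`; `e(x) = exp(2πix)` is `Literature.NumberTheory.LFunctions.VdC.e`)

* Discrete Fourier analysis on `ℤ/Hℤ` realised on `Finset.range H` / `Finset.Icc 1 H`:
  `sum_e_mul_div` (orthogonality `∑_{ξ<H} e(kξ/H) = H·1_{H ∣ k}`), `indicator_dvd_eq_sum_e`,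
  `dft` (`G(ξ) = (1/H)∑_{j=1}^H x_j e(-jξ/H)`), `pext` (Fourier series = periodic extension),
  `pext_eq_self` (inversion), `norm_dft_le`, `norm_pext_le`, `sum_norm_sq_dft(_neg_sub)`
  (Plancherel, also along `ξ ↦ -ξ - c`).
* `primeExpSum` (`S(θ) = ∑_{p∈𝒫} e(θp)/p`, (3.16)), `largeFreq` (the set `Ξ`), `bilin` (the left
  side of (3.17)), `bilinPer` ((3.18)), `bilinPer_eq_fourier` (the Fourier expansion in the
  proof), `norm_bilin_sub_bilinPer_le` (periodisation costs `|h| #𝒫`), `norm_bilinPer_le`,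
  and the assembled **Lemma 3.6**: `norm_bilin_le`
  `|T| ≤ |h| #𝒫 + τH + H (∑_{p∈𝒫} 1/p) ∑_{ξ∈Ξ} |G₂(ξ)|`.
* `addQuadruples`, `norm_primeExpSum_pow_four`, and `card_largeFreq_le`:
  `#Ξ ≤ a H τ⁻⁴ p_min⁻⁴ #{p₁ + p₂ = p₃ + p₄}` when `𝒫 ⊆ [p_min, p_max]`, `2|h| p_max < H`.

## References
* T. Tao, *The logarithmically averaged Chowla and Elliott conjectures for two-point
  correlations*, Forum Math. Pi 4 (2016), e8; arXiv:1509.05422, §3: Lemma 3.6 and its proof,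
  Lemma 3.7 (proof and footnote 5), Remark 3.8.

## Design choices
* Frequencies are parametrised as `hξ/H - bη/a` (`ξ ∈ ℤ/Hℤ`, `η ∈ ℤ/aℤ`); Tao writes
  `-(b+h)η/a - hξ/H`, the image under the bijection `ξ ↦ -ξ - (H/a)η`, so `largeFreq` is the same
  set of values of `S_H` and the final bound has the same shape; with this parametrisation the
  large-frequency sum carries `G₂` (transform of the second factor) rather than `G₁` — immaterial
  in the application, where `x₁ = x₂ = (λ(an+j))_j`.
* `x₁, x₂ : ℤ → ℂ` with hypotheses only on `[1, H]`; `𝒫` is any finite set of positive integers.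
* All constants explicit; no asymptotic notation.
-/

open Finset Real Complex

noncomputable section

namespace Literature.NumberTheory.LFunctions

namespace Tao2016

open VdC

/-! ### Orthogonality of additive characters mod `H` -/

/-- `e(k ξ / H)` as a power: `e(k ξ / H) = e(k / H)^ξ`. [folklore] -/
theorem e_mul_div_natCast (k : ℤ) (H ξ : ℕ) :
    e (k * ξ / H) = e (k / H) ^ ξ := by
  induction ξ with
  | zero => simp [e_zero]
  | succ n ih =>
    rw [pow_succ, ← ih, ← e_add]
    congr 1
    push_cast
    ring

/-- `e(k / H) = 1` iff `H ∣ k` (`H ≥ 1`). [folklore] -/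
theorem e_div_eq_one_iff {H : ℕ} (hH : 0 < H) (k : ℤ) : e (k / H) = 1 ↔ (H : ℤ) ∣ k := by
  have hH0 : (H : ℝ) ≠ 0 := by exact_mod_cast hH.ne'
  constructor
  · intro h1
    unfold e at h1
    obtain ⟨n, hn⟩ := Complex.exp_eq_one_iff.1 h1
    have h2 : ((2 * π * (k / H : ℝ) : ℝ) : ℂ) * Complex.I = ((n * (2 * π) : ℝ) : ℂ) * Complex.I := by
      rw [hn]; push_cast; ring
    have h3 := mul_right_cancel₀ Complex.I_ne_zero h2
    have h4 : 2 * π * ((k : ℝ) / H) = n * (2 * π) := by exact_mod_cast h3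
    have h5 : (k : ℝ) / H = n := by nlinarith [Real.pi_pos]
    rw [div_eq_iff hH0] at h5
    refine ⟨n, ?_⟩
    have : (k : ℝ) = ((H * n : ℤ) : ℝ) := by push_cast; rw [h5]; ring
    exact_mod_cast this
  · rintro ⟨m, rfl⟩
    have : (((H : ℤ) * m : ℤ) : ℝ) / (H : ℝ) = (m : ℝ) := by
      push_cast
      field_simp
    rw [this]
    exact e_int m

/-- **Orthogonality**: `∑_{ξ < H} e(k ξ / H) = H` if `H ∣ k` and `= 0` otherwise.
[folklore] -/
theorem sum_e_mul_div (k : ℤ) {H : ℕ} (hH : 0 < H) :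
    ∑ ξ ∈ range H, e (k * ξ / H) = if (H : ℤ) ∣ k then (H : ℂ) else 0 := by
  simp_rw [e_mul_div_natCast]
  split_ifs with hdiv
  · rw [(e_div_eq_one_iff hH k).2 hdiv]
    simp
  · have hne : e (k / H) ≠ 1 := fun h => hdiv ((e_div_eq_one_iff hH k).1 h)
    rw [geom_sum_eq hne]
    have : e (k / H) ^ H = 1 := by
      rw [← e_mul_div_natCast]
      have : (k * H : ℝ) / H = (k : ℝ) := by
        have hH0 : (H : ℝ) ≠ 0 := by exact_mod_cast hH.ne'
        field_simp
      rw [show ((k : ℝ) * (H : ℕ) / (H : ℕ) : ℝ) = k from by exact_mod_cast this]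
      exact e_int k
    rw [this, sub_self, zero_div]

/-- Detecting a congruence: `(1/a) ∑_{η < a} e(m η / a) = 1` if `a ∣ m`, else `0`. [folklore] -/
theorem indicator_dvd_eq_sum_e (m : ℤ) {a : ℕ} (ha : 0 < a) :
    (if (a : ℤ) ∣ m then (1 : ℂ) else 0) = (1 / a : ℂ) * ∑ η ∈ range a, e (m * η / a) := by
  rw [sum_e_mul_div m ha]
  have ha0 : (a : ℂ) ≠ 0 := by exact_mod_cast ha.ne'
  split_ifs <;> simp [ha0]

/-! ### Discrete Fourier transform on `[1, H]` -/

/-- The Fourier coefficient `G(ξ) = (1/H) ∑_{j=1}^H x_j e(-j ξ / H)` (`ξ ∈ ℤ`).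
[cite: TaoFMP2016, §3 (proof of Lemma 3.6)] -/
def dft (H : ℕ) (x : ℤ → ℂ) (ξ : ℤ) : ℂ :=
  (1 / H : ℂ) * ∑ j ∈ Icc (1 : ℤ) H, x j * e (-(j * ξ / H))

/-- The periodic extension `x̃(m) = ∑_{ξ < H} G(ξ) e(m ξ / H)` (Fourier inversion formula).
[folklore] -/
def pext (H : ℕ) (x : ℤ → ℂ) (m : ℤ) : ℂ :=
  ∑ ξ ∈ range H, dft H x ξ * e (m * ξ / H)

/-- **Fourier inversion** on `[1, H]`: `∑_{ξ < H} G(ξ) e(j ξ / H) = x_j` for `1 ≤ j ≤ H`.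
[folklore] -/
theorem pext_eq_self {H : ℕ} (hH : 0 < H) (x : ℤ → ℂ) {j : ℤ} (hj : j ∈ Icc (1 : ℤ) H) :
    pext H x j = x j := by
  unfold pext dft
  have hH0 : (H : ℂ) ≠ 0 := by exact_mod_cast hH.ne'
  have key : ∀ j' ∈ Icc (1 : ℤ) H,
      ∑ ξ ∈ range H, e (-(j' * ξ / H)) * e (j * ξ / H) = if j' = j then (H : ℂ) else 0 := by
    intro j' hj'
    have h1 : ∀ ξ ∈ range H, e (-(j' * ξ / H)) * e (j * ξ / H) = e ((j - j') * ξ / H) := by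
      intro ξ _
      rw [← e_add]
      congr 1
      ring
    rw [sum_congr rfl h1]
    have h2 := sum_e_mul_div (j - j') hH
    push_cast at h2
    rw [h2]
    simp only [mem_Icc] at hj hj'
    by_cases hjj : j' = j
    · subst hjj
      simp
    · rw [if_neg, if_neg hjj]
      rintro ⟨c, hc⟩
      have hlt : |j - j'| < H := by rw [abs_lt]; constructor <;> linarith
      have hne : j - j' ≠ 0 := sub_ne_zero.2 (Ne.symm hjj)
      have hc0 : c ≠ 0 := by
        rintro rfl
        rw [mul_zero] at hc
        exact hne hc
      rw [hc, abs_mul, Nat.abs_cast] at hlt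
      have h1c : (1 : ℤ) ≤ |c| := Int.one_le_abs hc0
      have hH1 : (0 : ℤ) < H := by exact_mod_cast hH
      nlinarith
  calc ∑ ξ ∈ range H, (1 / H : ℂ) * (∑ j' ∈ Icc (1 : ℤ) H, x j' * e (-(j' * ξ / H)))
          * e (j * ξ / H)
      = ∑ ξ ∈ range H, ∑ j' ∈ Icc (1 : ℤ) H,
          (1 / H : ℂ) * x j' * (e (-(j' * ξ / H)) * e (j * ξ / H)) := by
        refine sum_congr rfl fun ξ _ => ?_
        rw [mul_sum, sum_mul]
        refine sum_congr rfl fun j' _ => ?_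
        ring
    _ = ∑ j' ∈ Icc (1 : ℤ) H,
          (1 / H : ℂ) * x j' * ∑ ξ ∈ range H, e (-(j' * ξ / H)) * e (j * ξ / H) := by
        rw [sum_comm]
        refine sum_congr rfl fun j' _ => ?_
        rw [mul_sum]
    _ = ∑ j' ∈ Icc (1 : ℤ) H, (1 / H : ℂ) * x j' * (if j' = j then (H : ℂ) else 0) :=
        sum_congr rfl fun j' hj' => by rw [key j' hj']
    _ = x j := by
        simp_rw [mul_ite, mul_zero]
        rw [sum_ite_eq', if_pos hj]
        field_simp

/-- `pext` is `H`-periodic. [folklore] -/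
theorem pext_add_mul (H : ℕ) (hH : 0 < H) (x : ℤ → ℂ) (m k : ℤ) :
    pext H x (m + H * k) = pext H x m := by
  unfold pext
  refine sum_congr rfl fun ξ _ => ?_
  congr 1
  have hH0 : (H : ℝ) ≠ 0 := by exact_mod_cast hH.ne'
  have : ((m + H * k : ℤ) : ℝ) * ξ / H = (m : ℝ) * ξ / H + ((k * ξ : ℤ) : ℝ) := by
    push_cast
    field_simp
  rw [this, e_add_int]

/-- Every integer is congruent mod `H ≥ 1` to an element of `[1, H]`. [folklore] -/
theorem exists_rep_Icc {H : ℕ} (hH : 0 < H) (m : ℤ) :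
    ∃ j ∈ Icc (1 : ℤ) H, ∃ k : ℤ, m = j + H * k := by
  have hH' : (0 : ℤ) < H := by exact_mod_cast hH
  refine ⟨(m - 1) % H + 1, ?_, (m - 1) / H, ?_⟩
  · simp only [mem_Icc]
    constructor
    · linarith [Int.emod_nonneg (m - 1) hH'.ne']
    · linarith [Int.emod_lt_of_pos (m - 1) hH']
  · linarith [Int.emod_add_mul_ediv (m - 1) H]

/-- `|x̃(m)| ≤ 1` everywhere if `|x_j| ≤ 1` on `[1, H]`. [folklore] -/
theorem norm_pext_le {H : ℕ} (hH : 0 < H) {x : ℤ → ℂ} (hx : ∀ j ∈ Icc (1 : ℤ) H, ‖x j‖ ≤ 1)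
    (m : ℤ) : ‖pext H x m‖ ≤ 1 := by
  obtain ⟨j, hj, k, rfl⟩ := exists_rep_Icc hH m
  rw [pext_add_mul H hH, pext_eq_self hH x hj]
  exact hx j hj

/-- `|G(ξ)| ≤ 1` if `|x_j| ≤ 1` on `[1, H]`. [folklore] -/
theorem norm_dft_le {H : ℕ} (hH : 0 < H) {x : ℤ → ℂ} (hx : ∀ j ∈ Icc (1 : ℤ) H, ‖x j‖ ≤ 1)
    (ξ : ℤ) : ‖dft H x ξ‖ ≤ 1 := by
  unfold dft
  have hH0 : (0 : ℝ) < H := by exact_mod_cast hH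
  rw [norm_mul]
  have h1 : ‖(1 / H : ℂ)‖ = 1 / H := by
    rw [norm_div, norm_one, Complex.norm_natCast]
  rw [h1]
  have h2 : ‖∑ j ∈ Icc (1 : ℤ) H, x j * e (-(j * ξ / H))‖ ≤ H := by
    refine (norm_sum_le _ _).trans ?_
    calc ∑ j ∈ Icc (1 : ℤ) H, ‖x j * e (-(j * ξ / H))‖ ≤ ∑ j ∈ Icc (1 : ℤ) H, (1 : ℝ) := by
          refine sum_le_sum fun j hj => ?_
          rw [norm_mul, norm_e, mul_one]
          exact hx j hj
      _ = H := by simp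
  calc 1 / (H : ℝ) * ‖∑ j ∈ Icc (1 : ℤ) H, x j * e (-(j * ξ / H))‖ ≤ 1 / H * H := by gcongr
    _ = 1 := by field_simp

/-- **Plancherel along a complete residue system**: if `ζ : ℕ → ℤ` runs through all residues
mod `H` as `ξ < H` does (expressed through orthogonality), then
`∑_{ξ < H} |G(ζ(ξ))|² = (1/H) ∑_j |x_j|²`. [folklore] -/
theorem sum_norm_sq_dft_comp {H : ℕ} (hH : 0 < H) (x : ℤ → ℂ) (ζ : ℕ → ℤ)
    (hζ : ∀ k : ℤ, ∑ ξ ∈ range H, e (k * ζ ξ / H) = if (H : ℤ) ∣ k then (H : ℂ) else 0) :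
    ∑ ξ ∈ range H, ‖dft H x (ζ ξ)‖ ^ 2 = (1 / H : ℝ) * ∑ j ∈ Icc (1 : ℤ) H, ‖x j‖ ^ 2 := by
  have hH0 : (H : ℂ) ≠ 0 := by exact_mod_cast hH.ne'
  -- work in `ℂ`
  have hC : ∀ z : ℂ, ((‖z‖ : ℂ)) ^ 2 = z * (starRingEnd ℂ) z := fun z => by
    rw [Complex.mul_conj, Complex.normSq_eq_norm_sq]; push_cast; ring
  have key : ∀ j ∈ Icc (1 : ℤ) H, ∀ j' ∈ Icc (1 : ℤ) H,
      ∑ ξ ∈ range H, e (-(j * ζ ξ / H)) * (starRingEnd ℂ) (e (-(j' * ζ ξ / H))) =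
        if j' = j then (H : ℂ) else 0 := by
    intro j hj j' hj'
    have h1 : ∀ ξ ∈ range H, e (-(j * ζ ξ / H)) * (starRingEnd ℂ) (e (-(j' * ζ ξ / H))) =
        e ((j' - j) * ζ ξ / H) := by
      intro ξ _
      rw [← e_neg, ← e_add]
      congr 1
      ring
    rw [sum_congr rfl h1]
    have h2 := hζ (j' - j)
    push_cast at h2
    rw [h2]
    simp only [mem_Icc] at hj hj'
    by_cases hjj : j' = j
    · subst hjj
      simp
    · rw [if_neg, if_neg hjj]
      rintro ⟨c, hc⟩
      have hlt : |j' - j| < H := by rw [abs_lt]; constructor <;> linarith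
      have hne : j' - j ≠ 0 := sub_ne_zero.2 hjj
      have hc0 : c ≠ 0 := by
        rintro rfl
        rw [mul_zero] at hc
        exact hne hc
      rw [hc, abs_mul, Nat.abs_cast] at hlt
      have h1c : (1 : ℤ) ≤ |c| := Int.one_le_abs hc0
      have hH1 : (0 : ℤ) < H := by exact_mod_cast hH
      nlinarith
  have main : ((∑ ξ ∈ range H, ‖dft H x (ζ ξ)‖ ^ 2 : ℝ) : ℂ) =
      (((1 / H : ℝ) * ∑ j ∈ Icc (1 : ℤ) H, ‖x j‖ ^ 2 : ℝ) : ℂ) := by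
    push_cast
    simp_rw [hC]
    unfold dft
    calc ∑ ξ ∈ range H, (1 / (H : ℂ) * ∑ j ∈ Icc (1 : ℤ) H, x j * e (-(j * (ζ ξ) / H))) *
          (starRingEnd ℂ) (1 / (H : ℂ) * ∑ j ∈ Icc (1 : ℤ) H, x j * e (-(j * (ζ ξ) / H)))
        = ∑ ξ ∈ range H, (1 / (H : ℂ)) * (1 / (H : ℂ)) * ∑ j ∈ Icc (1 : ℤ) H, ∑ j' ∈ Icc (1 : ℤ) H,
            x j * (starRingEnd ℂ) (x j') *
              (e (-(j * ζ ξ / H)) * (starRingEnd ℂ) (e (-(j' * ζ ξ / H)))) := by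
          refine sum_congr rfl fun ξ _ => ?_
          rw [map_mul, map_div₀, map_one, Complex.conj_natCast, map_sum]
          have : (1 / (H : ℂ)) * (∑ j ∈ Icc (1 : ℤ) H, x j * e (-(j * (ζ ξ) / H))) *
              (1 / (H : ℂ) * ∑ i ∈ Icc (1 : ℤ) H, (starRingEnd ℂ) (x i * e (-(i * (ζ ξ) / H)))) =
              (1 / (H : ℂ)) * (1 / (H : ℂ)) * ((∑ j ∈ Icc (1 : ℤ) H, x j * e (-(j * (ζ ξ) / H))) *
              ∑ i ∈ Icc (1 : ℤ) H, (starRingEnd ℂ) (x i * e (-(i * (ζ ξ) / H)))) := by ring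
          rw [this, sum_mul_sum]
          congr 1
          refine sum_congr rfl fun j _ => sum_congr rfl fun j' _ => ?_
          rw [map_mul]
          ring
      _ = (1 / (H : ℂ)) * (1 / (H : ℂ)) * ∑ j ∈ Icc (1 : ℤ) H, ∑ j' ∈ Icc (1 : ℤ) H,
            x j * (starRingEnd ℂ) (x j') *
              ∑ ξ ∈ range H, e (-(j * ζ ξ / H)) * (starRingEnd ℂ) (e (-(j' * ζ ξ / H))) := by
          rw [← mul_sum, sum_comm]
          congr 1
          refine sum_congr rfl fun j _ => ?_
          rw [sum_comm]
          refine sum_congr rfl fun j' _ => ?_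
          rw [mul_sum]
      _ = (1 / (H : ℂ)) * (1 / (H : ℂ)) * ∑ j ∈ Icc (1 : ℤ) H,
            x j * (starRingEnd ℂ) (x j) * H := by
          congr 1
          refine sum_congr rfl fun j hj => ?_
          rw [sum_congr rfl fun j' hj' => by rw [key j hj j' hj']]
          simp_rw [mul_ite, mul_zero]
          rw [sum_ite_eq', if_pos hj]
      _ = 1 / (H : ℂ) * ∑ j ∈ Icc (1 : ℤ) H, x j * (starRingEnd ℂ) (x j) := by
          rw [← sum_mul]
          field_simp
  exact_mod_cast main

/-- The identity map is a complete residue system: plain orthogonality. [folklore] -/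
theorem crs_id {H : ℕ} (hH : 0 < H) (k : ℤ) :
    ∑ ξ ∈ range H, e (k * ((ξ : ℕ) : ℤ) / H) = if (H : ℤ) ∣ k then (H : ℂ) else 0 := by
  have := sum_e_mul_div k hH
  push_cast at this ⊢
  exact this

/-- `ξ ↦ -ξ - c` is a complete residue system. [folklore] -/
theorem crs_neg_sub {H : ℕ} (hH : 0 < H) (c k : ℤ) :
    ∑ ξ ∈ range H, e (k * ((-(ξ : ℤ) - c : ℤ)) / H) = if (H : ℤ) ∣ k then (H : ℂ) else 0 := by
  have hH0 : (H : ℝ) ≠ 0 := by exact_mod_cast hH.ne'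
  have h1 : ∀ ξ ∈ range H, e (k * ((-(ξ : ℤ) - c : ℤ)) / H) =
      e (-(k * c / H)) * e ((-k) * (ξ : ℕ) / H) := by
    intro ξ _
    rw [← e_add]
    congr 1
    push_cast
    field_simp
    ring
  have h2 := sum_e_mul_div (-k) hH
  push_cast at h2
  rw [sum_congr rfl h1, ← mul_sum, h2]
  simp only [dvd_neg]
  split_ifs with hdiv
  · obtain ⟨m, rfl⟩ := hdiv
    have : -((H : ℤ) * m * c : ℝ) / H = ((-(m * c) : ℤ) : ℝ) := by
      push_cast
      field_simp
    push_cast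
    rw [show -(↑H * ↑m * (c : ℝ) / ↑H) = -((H : ℤ) * m * c : ℝ) / H by push_cast; ring, this, e_int,
      one_mul]
  · rw [mul_zero]

/-- **Plancherel**: `∑_{ξ < H} |G(ξ)|² = (1/H) ∑_j |x_j|²`. [folklore] -/
theorem sum_norm_sq_dft {H : ℕ} (hH : 0 < H) (x : ℤ → ℂ) :
    ∑ ξ ∈ range H, ‖dft H x ξ‖ ^ 2 = (1 / H : ℝ) * ∑ j ∈ Icc (1 : ℤ) H, ‖x j‖ ^ 2 :=
  sum_norm_sq_dft_comp hH x (fun ξ => (ξ : ℤ)) (crs_id hH)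

/-- Twisted Plancherel: `∑_{ξ < H} |G(-ξ - c)|² = (1/H) ∑_j |x_j|²`. [folklore] -/
theorem sum_norm_sq_dft_neg_sub {H : ℕ} (hH : 0 < H) (x : ℤ → ℂ) (c : ℤ) :
    ∑ ξ ∈ range H, ‖dft H x (-(ξ : ℤ) - c)‖ ^ 2 = (1 / H : ℝ) * ∑ j ∈ Icc (1 : ℤ) H, ‖x j‖ ^ 2 :=
  sum_norm_sq_dft_comp hH x (fun ξ => -(ξ : ℤ) - c) (crs_neg_sub hH c)

/-- Plancherel bound: `∑_{ξ < H} |G(ζ ξ)|² ≤ 1` for `|x_j| ≤ 1`, along a complete residue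
system. [folklore] -/
theorem sum_norm_sq_dft_comp_le_one {H : ℕ} (hH : 0 < H) {x : ℤ → ℂ}
    (hx : ∀ j ∈ Icc (1 : ℤ) H, ‖x j‖ ≤ 1) (ζ : ℕ → ℤ)
    (hζ : ∀ k : ℤ, ∑ ξ ∈ range H, e (k * ζ ξ / H) = if (H : ℤ) ∣ k then (H : ℂ) else 0) :
    ∑ ξ ∈ range H, ‖dft H x (ζ ξ)‖ ^ 2 ≤ 1 := by
  rw [sum_norm_sq_dft_comp hH x ζ hζ]
  have hH0 : (0 : ℝ) < H := by exact_mod_cast hH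
  have : ∑ j ∈ Icc (1 : ℤ) H, ‖x j‖ ^ 2 ≤ H := by
    calc ∑ j ∈ Icc (1 : ℤ) H, ‖x j‖ ^ 2 ≤ ∑ j ∈ Icc (1 : ℤ) H, (1 : ℝ) := by
          refine sum_le_sum fun j hj => ?_
          have h1 := hx j hj
          have h0 := norm_nonneg (x j)
          nlinarith
      _ = H := by simp
  calc (1 / H : ℝ) * ∑ j ∈ Icc (1 : ℤ) H, ‖x j‖ ^ 2 ≤ (1 / H) * H := by gcongr
    _ = 1 := by field_simp

/-! ### The circle-method estimate (Tao 2016, Lemma 3.6) -/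

/-- The prime exponential sum `S(θ) = ∑_{p ∈ P} e(θ p) / p` (Tao 2016, (3.16), with `c_p = 1`).
[cite: TaoFMP2016, §3 (3.16)] -/
def primeExpSum (P : Finset ℕ) (θ : ℝ) : ℂ := ∑ p ∈ P, (1 / p : ℂ) * e (θ * p)

/-- `|S(θ)| ≤ ∑_{p ∈ P} 1/p`. [folklore] -/
theorem norm_primeExpSum_le (P : Finset ℕ) (θ : ℝ) :
    ‖primeExpSum P θ‖ ≤ ∑ p ∈ P, (1 / p : ℝ) := by
  unfold primeExpSum
  refine (norm_sum_le _ _).trans (le_of_eq (sum_congr rfl fun p _ => ?_))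
  rw [norm_mul, norm_e, mul_one, norm_div, norm_one, Complex.norm_natCast]

/-- The set `Ξ` of **large frequencies**: those `ξ ∈ ℤ/Hℤ` for which
`|S(h ξ / H - b η / a)| ≥ τ` for some `η ∈ ℤ/aℤ` (Tao 2016, Lemma 3.6, with the frequencies
parametrised as `h ξ/H - b η/a`; Tao writes `-(b+h)η/a - hξ/H`, which is the same set of
arguments after the substitution `ξ ↦ -ξ - (H/a)η`). [cite: TaoFMP2016, §3 Lemma 3.6] -/
def largeFreq (H a : ℕ) (b h : ℤ) (P : Finset ℕ) (τ : ℝ) : Finset ℕ := by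
  classical
  exact (range H).filter fun ξ => ∃ η ∈ range a, τ ≤ ‖primeExpSum P (h * ξ / H - b * η / a)‖

/-- The bilinear expression of Tao 2016, Lemma 3.6 (left side of (3.17), `c_p = 1`):
`T = ∑_{p ∈ P} (1/p) ∑_{j : j, j + ph ∈ [1, H], j ≡ pb (a)} x₁(j) x₂(j + ph)`.
[cite: TaoFMP2016, §3 (3.17)] -/
def bilin (H a : ℕ) (b h : ℤ) (P : Finset ℕ) (x₁ x₂ : ℤ → ℂ) : ℂ :=
  ∑ p ∈ P, (1 / p : ℂ) * ∑ j ∈ (Icc (1 : ℤ) H).filter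
    (fun j => j + p * h ∈ Icc (1 : ℤ) H ∧ (a : ℤ) ∣ j - p * b), x₁ j * x₂ (j + p * h)

/-- The periodised bilinear expression (Tao 2016, (3.18)):
`∑_p (1/p) ∑_{j ∈ [1,H], j ≡ pb (a)} x₁(j) x̃₂(j + ph)`. [cite: TaoFMP2016, §3 (3.18)] -/
def bilinPer (H a : ℕ) (b h : ℤ) (P : Finset ℕ) (x₁ x₂ : ℤ → ℂ) : ℂ :=
  ∑ p ∈ P, (1 / p : ℂ) * ∑ j ∈ (Icc (1 : ℤ) H).filter (fun j => (a : ℤ) ∣ j - p * b),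
    x₁ j * pext H x₂ (j + p * h)

/-- The number of `j ∈ [1, H]` with `j + m ∉ [1, H]` is at most `|m|`. [folklore] -/
theorem card_filter_add_not_mem_Icc_le (H : ℕ) (m : ℤ) :
    (#((Icc (1 : ℤ) H).filter fun j => j + m ∉ Icc (1 : ℤ) H) : ℤ) ≤ |m| := by
  rcases le_or_gt 0 m with hm | hm
  · rw [abs_of_nonneg hm]
    calc (#((Icc (1 : ℤ) H).filter fun j => j + m ∉ Icc (1 : ℤ) H) : ℤ)
        ≤ #(Ioc ((H : ℤ) - m) H) := by
          exact_mod_cast card_le_card fun j hj => by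
            simp only [mem_filter, mem_Icc, not_and, not_le, mem_Ioc] at hj ⊢
            constructor
            · have := hj.2 (by linarith [hj.1.1])
              linarith
            · exact hj.1.2
      _ = m := by
          rw [Int.card_Ioc]
          rw [Int.toNat_of_nonneg (by linarith)]
          ring
  · rw [abs_of_neg hm]
    calc (#((Icc (1 : ℤ) H).filter fun j => j + m ∉ Icc (1 : ℤ) H) : ℤ)
        ≤ #(Ico (1 : ℤ) (1 - m)) := by
          exact_mod_cast card_le_card fun j hj => by
            simp only [mem_filter, mem_Icc, not_and, not_le, mem_Ico] at hj ⊢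
            refine ⟨hj.1.1, ?_⟩
            by_contra hcon
            have := hj.2 (by linarith)
            linarith [hj.1.2]
      _ = -m := by
          rw [Int.card_Ico, Int.toNat_of_nonneg (by linarith)]
          ring

/-- **Periodisation costs `|h| #P`**: `|T - T_per| ≤ |h| · #P` for `|x_i| ≤ 1`
(Tao 2016, proof of Lemma 3.6: "If we remove the constraint that `j + ph ∈ [1,H]`, we incur an
error of `O(∑_p (1/p) |ph|)`"). [cite: TaoFMP2016, §3 (proof of Lemma 3.6)] -/
theorem norm_bilin_sub_bilinPer_le {H a : ℕ} (hH : 0 < H) (b h : ℤ) (P : Finset ℕ)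
    (hP : ∀ p ∈ P, 0 < p) {x₁ x₂ : ℤ → ℂ} (hx₁ : ∀ j ∈ Icc (1 : ℤ) H, ‖x₁ j‖ ≤ 1)
    (hx₂ : ∀ j ∈ Icc (1 : ℤ) H, ‖x₂ j‖ ≤ 1) :
    ‖bilin H a b h P x₁ x₂ - bilinPer H a b h P x₁ x₂‖ ≤ |h| * #P := by
  unfold bilin bilinPer
  rw [← sum_sub_distrib]
  have key : ∀ p ∈ P, ‖(1 / p : ℂ) * ∑ j ∈ (Icc (1 : ℤ) H).filter
      (fun j => j + p * h ∈ Icc (1 : ℤ) H ∧ (a : ℤ) ∣ j - p * b), x₁ j * x₂ (j + p * h) -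
      (1 / p : ℂ) * ∑ j ∈ (Icc (1 : ℤ) H).filter (fun j => (a : ℤ) ∣ j - p * b),
        x₁ j * pext H x₂ (j + p * h)‖ ≤ |(h : ℝ)| := by
    intro p hp
    rw [← Int.cast_abs]
    have hp0 : (0 : ℝ) < p := by exact_mod_cast hP p hp
    set D := (Icc (1 : ℤ) H).filter (fun j => (a : ℤ) ∣ j - p * b) with hD
    -- replace `x₂` by `pext x₂` in the first sum and split the second
    have h1 : ∑ j ∈ (Icc (1 : ℤ) H).filter
        (fun j => j + p * h ∈ Icc (1 : ℤ) H ∧ (a : ℤ) ∣ j - p * b), x₁ j * x₂ (j + p * h) =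
        ∑ j ∈ D.filter (fun j => j + p * h ∈ Icc (1 : ℤ) H), x₁ j * pext H x₂ (j + p * h) := by
      rw [hD, filter_filter]
      have : (Icc (1 : ℤ) H).filter (fun j => j + p * h ∈ Icc (1 : ℤ) H ∧ (a : ℤ) ∣ j - p * b) =
          (Icc (1 : ℤ) H).filter (fun j => (a : ℤ) ∣ j - p * b ∧ j + p * h ∈ Icc (1 : ℤ) H) :=
        filter_congr fun j _ => and_comm
      rw [this]
      refine sum_congr rfl fun j hj => ?_
      rw [pext_eq_self hH x₂ (mem_filter.1 hj).2.2]
    have h2 : ∑ j ∈ D, x₁ j * pext H x₂ (j + p * h) =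
        ∑ j ∈ D.filter (fun j => j + p * h ∈ Icc (1 : ℤ) H), x₁ j * pext H x₂ (j + p * h) +
        ∑ j ∈ D.filter (fun j => ¬ (j + p * h ∈ Icc (1 : ℤ) H)), x₁ j * pext H x₂ (j + p * h) :=
      (sum_filter_add_sum_filter_not D _ _).symm
    rw [h1, h2, ← mul_sub, sub_add_cancel_left, norm_mul, norm_div, norm_one,
      Complex.norm_natCast, norm_neg]
    -- the leftover sum has at most `p |h|` terms of size `≤ 1`
    have h3 : ‖∑ j ∈ D.filter (fun j => ¬ (j + p * h ∈ Icc (1 : ℤ) H)),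
        x₁ j * pext H x₂ (j + p * h)‖ ≤ p * |h| := by
      refine (norm_sum_le _ _).trans ?_
      calc ∑ j ∈ D.filter (fun j => ¬ (j + p * h ∈ Icc (1 : ℤ) H)), ‖x₁ j * pext H x₂ (j + p * h)‖
          ≤ ∑ j ∈ D.filter (fun j => ¬ (j + p * h ∈ Icc (1 : ℤ) H)), (1 : ℝ) := by
            refine sum_le_sum fun j hj => ?_
            have hjI : j ∈ Icc (1 : ℤ) H := (mem_filter.1 (mem_filter.1 hj).1).1
            rw [norm_mul]
            exact mul_le_one₀ (hx₁ j hjI) (norm_nonneg _) (norm_pext_le hH hx₂ _)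
        _ = #(D.filter (fun j => ¬ (j + p * h ∈ Icc (1 : ℤ) H))) := by simp
        _ ≤ #((Icc (1 : ℤ) H).filter fun j => j + p * h ∉ Icc (1 : ℤ) H) := by
            exact_mod_cast card_le_card (by
              rw [hD, filter_filter]
              exact fun j hj => mem_filter.2 ⟨(mem_filter.1 hj).1, (mem_filter.1 hj).2.2⟩)
        _ ≤ p * |h| := by
            have := card_filter_add_not_mem_Icc_le H (p * h)
            rw [abs_mul, Nat.abs_cast] at this
            exact_mod_cast this
    calc 1 / (p : ℝ) * ‖∑ j ∈ D.filter (fun j => ¬ (j + p * h ∈ Icc (1 : ℤ) H)),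
          x₁ j * pext H x₂ (j + p * h)‖ ≤ 1 / p * (p * |h|) := by gcongr
      _ = |h| := by field_simp
  calc ‖∑ p ∈ P, ((1 / p : ℂ) * ∑ j ∈ (Icc (1 : ℤ) H).filter
        (fun j => j + p * h ∈ Icc (1 : ℤ) H ∧ (a : ℤ) ∣ j - p * b), x₁ j * x₂ (j + p * h) -
        (1 / p : ℂ) * ∑ j ∈ (Icc (1 : ℤ) H).filter (fun j => (a : ℤ) ∣ j - p * b),
          x₁ j * pext H x₂ (j + p * h))‖
      ≤ ∑ p ∈ P, |(h : ℝ)| := (norm_sum_le _ _).trans (sum_le_sum key)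
    _ = |h| * #P := by rw [sum_const, nsmul_eq_mul, mul_comm, Int.cast_abs]

/-- Reordering a fourfold finite sum. [folklore] -/
theorem sum_comm4 {α₁ α₂ α₃ α₄ M : Type*} [AddCommMonoid M] (A : Finset α₁) (B : Finset α₂)
    (C : Finset α₃) (D : Finset α₄) (F : α₁ → α₂ → α₃ → α₄ → M) :
    ∑ p ∈ A, ∑ j ∈ B, ∑ η ∈ C, ∑ ξ ∈ D, F p j η ξ =
      ∑ ξ ∈ D, ∑ η ∈ C, ∑ j ∈ B, ∑ p ∈ A, F p j η ξ := by
  calc ∑ p ∈ A, ∑ j ∈ B, ∑ η ∈ C, ∑ ξ ∈ D, F p j η ξ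
      = ∑ p ∈ A, ∑ j ∈ B, ∑ ξ ∈ D, ∑ η ∈ C, F p j η ξ :=
        sum_congr rfl fun p _ => sum_congr rfl fun j _ => sum_comm
    _ = ∑ p ∈ A, ∑ ξ ∈ D, ∑ j ∈ B, ∑ η ∈ C, F p j η ξ := sum_congr rfl fun p _ => sum_comm
    _ = ∑ ξ ∈ D, ∑ p ∈ A, ∑ j ∈ B, ∑ η ∈ C, F p j η ξ := sum_comm
    _ = ∑ ξ ∈ D, ∑ p ∈ A, ∑ η ∈ C, ∑ j ∈ B, F p j η ξ :=
        sum_congr rfl fun ξ _ => sum_congr rfl fun p _ => sum_comm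
    _ = ∑ ξ ∈ D, ∑ η ∈ C, ∑ p ∈ A, ∑ j ∈ B, F p j η ξ := sum_congr rfl fun ξ _ => sum_comm
    _ = ∑ ξ ∈ D, ∑ η ∈ C, ∑ j ∈ B, ∑ p ∈ A, F p j η ξ :=
        sum_congr rfl fun ξ _ => sum_congr rfl fun η _ => sum_comm

/-- **Fourier expansion of the periodised bilinear form** (Tao 2016, proof of Lemma 3.6, the
display before "From the Cauchy-Schwarz inequality"): with `H = a H'`,
`T_per = (H/a) ∑_{ξ < H} ∑_{η < a} G₂(ξ) G₁(-ξ - H'η) S(hξ/H - bη/a)`.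
[cite: TaoFMP2016, §3 (proof of Lemma 3.6)] -/
theorem bilinPer_eq_fourier {H a H' : ℕ} (hH : 0 < H) (ha : 0 < a) (hHa : H = a * H') (b h : ℤ)
    (P : Finset ℕ) (x₁ x₂ : ℤ → ℂ) :
    bilinPer H a b h P x₁ x₂ = (H / a : ℂ) * ∑ ξ ∈ range H, ∑ η ∈ range a,
      dft H x₂ ξ * dft H x₁ (-(ξ : ℤ) - H' * η) * primeExpSum P (h * ξ / H - b * η / a) := by
  have hH0 : (H : ℂ) ≠ 0 := by exact_mod_cast hH.ne'
  have ha0 : (a : ℂ) ≠ 0 := by exact_mod_cast ha.ne'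
  have hHr : (H : ℝ) ≠ 0 := by exact_mod_cast hH.ne'
  have har : (a : ℝ) ≠ 0 := by exact_mod_cast ha.ne'
  -- the common fourfold expansion
  set F : ℕ → ℤ → ℕ → ℕ → ℂ := fun p j η ξ =>
    (1 / p : ℂ) * (1 / a : ℂ) * x₁ j * dft H x₂ ξ *
      e ((j - p * b) * η / a + (j + p * h) * ξ / H) with hF
  have lhs : bilinPer H a b h P x₁ x₂ =
      ∑ p ∈ P, ∑ j ∈ Icc (1 : ℤ) H, ∑ η ∈ range a, ∑ ξ ∈ range H, F p j η ξ := by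
    unfold bilinPer
    refine sum_congr rfl fun p _ => ?_
    rw [sum_filter, mul_sum]
    refine sum_congr rfl fun j _ => ?_
    rw [← boole_mul, indicator_dvd_eq_sum_e _ ha]
    unfold pext
    simp only [mul_sum, sum_mul]
    rw [sum_comm]
    refine sum_congr rfl fun η _ => sum_congr rfl fun ξ _ => ?_
    rw [hF]
    simp only
    rw [e_add]
    push_cast
    ring
  have rhs : (H / a : ℂ) * ∑ ξ ∈ range H, ∑ η ∈ range a,
      dft H x₂ ξ * dft H x₁ (-(ξ : ℤ) - H' * η) * primeExpSum P (h * ξ / H - b * η / a) =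
      ∑ ξ ∈ range H, ∑ η ∈ range a, ∑ j ∈ Icc (1 : ℤ) H, ∑ p ∈ P, F p j η ξ := by
    rw [mul_sum]
    refine sum_congr rfl fun ξ _ => ?_
    rw [mul_sum]
    refine sum_congr rfl fun η _ => ?_
    rw [dft.eq_def H x₁, primeExpSum]
    simp only [mul_sum, sum_mul]
    rw [sum_comm]
    refine sum_congr rfl fun j _ => sum_congr rfl fun p _ => ?_
    rw [hF]
    simp only
    have hphase : e (-(j * ((-(ξ : ℤ) - H' * η : ℤ) : ℝ) / H)) * e ((h * ξ / H - b * η / a) * p) =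
        e ((j - p * b) * η / a + (j + p * h) * ξ / H) := by
      rw [← e_add]
      congr 1
      have hHa' : (H : ℝ) = a * H' := by exact_mod_cast hHa
      push_cast
      rw [hHa']
      have hH'r : (H' : ℝ) ≠ 0 := by
        rintro h0
        rw [h0, mul_zero] at hHa'
        exact hHr hHa'
      field_simp
      ring
    rw [← hphase]
    push_cast
    field_simp
  rw [lhs, rhs, sum_comm4]

/-- Membership in the set of large frequencies. [folklore] -/
theorem mem_largeFreq {H a : ℕ} {b h : ℤ} {P : Finset ℕ} {τ : ℝ} {ξ : ℕ} :
    ξ ∈ largeFreq H a b h P τ ↔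
      ξ ∈ range H ∧ ∃ η ∈ range a, τ ≤ ‖primeExpSum P (h * ξ / H - b * η / a)‖ := by
  unfold largeFreq
  simp only [mem_filter]

/-- `Ξ ⊆ ℤ/Hℤ`. [folklore] -/
theorem largeFreq_subset (H a : ℕ) (b h : ℤ) (P : Finset ℕ) (τ : ℝ) :
    largeFreq H a b h P τ ⊆ range H := fun _ hξ => (mem_largeFreq.1 hξ).1

/-- **Bound for the periodised form** (Tao 2016, proof of Lemma 3.6: Cauchy–Schwarz and
Plancherel off the large frequencies, the trivial bound on them): for `|x_i| ≤ 1` and `τ ≥ 0`,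
`|T_per| ≤ τ H + H (∑_{p ∈ 𝒫} 1/p) ∑_{ξ ∈ Ξ} |G₂(ξ)|`. [cite: TaoFMP2016, §3 (proof of Lemma 3.6)] -/
theorem norm_bilinPer_le {H a H' : ℕ} (hH : 0 < H) (ha : 0 < a) (hHa : H = a * H') (b h : ℤ)
    (P : Finset ℕ) {x₁ x₂ : ℤ → ℂ} (hx₁ : ∀ j ∈ Icc (1 : ℤ) H, ‖x₁ j‖ ≤ 1)
    (hx₂ : ∀ j ∈ Icc (1 : ℤ) H, ‖x₂ j‖ ≤ 1) {τ : ℝ} (hτ : 0 ≤ τ) :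
    ‖bilinPer H a b h P x₁ x₂‖ ≤
      τ * H + H * (∑ p ∈ P, (1 / p : ℝ)) * ∑ ξ ∈ largeFreq H a b h P τ, ‖dft H x₂ ξ‖ := by
  rw [bilinPer_eq_fourier hH ha hHa b h P x₁ x₂, norm_mul]
  have hH0 : (0 : ℝ) < H := by exact_mod_cast hH
  have ha0 : (0 : ℝ) < a := by exact_mod_cast ha
  have hnorm : ‖(H / a : ℂ)‖ = H / a := by
    rw [norm_div, Complex.norm_natCast, Complex.norm_natCast]
  rw [hnorm]
  set s := ∑ p ∈ P, (1 / p : ℝ) with hs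
  have hs0 : 0 ≤ s := sum_nonneg fun p _ => by positivity
  set L := largeFreq H a b h P τ with hL
  set S := fun ξ η : ℕ => primeExpSum P (h * ξ / H - b * η / a) with hS
  set g : ℕ → ℕ → ℂ := fun ξ η =>
    dft H x₂ ξ * dft H x₁ (-(ξ : ℤ) - H' * η) * S ξ η with hg
  have hLsub : L ⊆ range H := largeFreq_subset H a b h P τ
  -- triangle inequality and splitting of the `ξ`-sum
  have h1 : ‖∑ ξ ∈ range H, ∑ η ∈ range a, g ξ η‖ ≤
      ∑ ξ ∈ range H \ L, ∑ η ∈ range a, ‖g ξ η‖ + ∑ ξ ∈ L, ∑ η ∈ range a, ‖g ξ η‖ := by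
    refine (norm_sum_le _ _).trans ?_
    rw [← sum_sdiff hLsub]
    gcongr with ξ _ ξ _ <;> exact norm_sum_le _ _
  -- off the large frequencies
  have h2 : ∑ ξ ∈ range H \ L, ∑ η ∈ range a, ‖g ξ η‖ ≤ τ * a := by
    calc ∑ ξ ∈ range H \ L, ∑ η ∈ range a, ‖g ξ η‖
        ≤ ∑ ξ ∈ range H \ L, ∑ η ∈ range a,
            τ * (‖dft H x₂ ξ‖ * ‖dft H x₁ (-(ξ : ℤ) - H' * η)‖) := by
          refine sum_le_sum fun ξ hξ => sum_le_sum fun η hη => ?_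
          rw [mem_sdiff] at hξ
          have hsmall : ‖S ξ η‖ ≤ τ := by
            by_contra hcon
            exact hξ.2 (mem_largeFreq.2 ⟨hξ.1, η, hη, (not_le.mp hcon).le⟩)
          rw [hg]
          simp only [norm_mul]
          calc ‖dft H x₂ ξ‖ * ‖dft H x₁ (-(ξ : ℤ) - H' * η)‖ * ‖S ξ η‖
              ≤ ‖dft H x₂ ξ‖ * ‖dft H x₁ (-(ξ : ℤ) - H' * η)‖ * τ := by gcongr
            _ = τ * (‖dft H x₂ ξ‖ * ‖dft H x₁ (-(ξ : ℤ) - H' * η)‖) := by ring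
      _ ≤ ∑ ξ ∈ range H, ∑ η ∈ range a,
            τ * (‖dft H x₂ ξ‖ * ‖dft H x₁ (-(ξ : ℤ) - H' * η)‖) :=
          sum_le_sum_of_subset_of_nonneg sdiff_subset fun ξ _ _ =>
            sum_nonneg fun η _ => by positivity
      _ = τ * ∑ η ∈ range a, ∑ ξ ∈ range H,
            ‖dft H x₂ ξ‖ * ‖dft H x₁ (-(ξ : ℤ) - H' * η)‖ := by
          rw [sum_comm, mul_sum]
          refine sum_congr rfl fun η _ => ?_
          rw [mul_sum]
      _ ≤ τ * ∑ η ∈ range a, (1 : ℝ) := by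
          gcongr with η hη
          -- AM–GM and Plancherel
          calc ∑ ξ ∈ range H, ‖dft H x₂ ξ‖ * ‖dft H x₁ (-(ξ : ℤ) - H' * η)‖
              ≤ ∑ ξ ∈ range H,
                  (‖dft H x₂ ξ‖ ^ 2 + ‖dft H x₁ (-(ξ : ℤ) - H' * η)‖ ^ 2) / 2 :=
                sum_le_sum fun ξ _ => by
                  nlinarith [sq_nonneg (‖dft H x₂ ξ‖ - ‖dft H x₁ (-(ξ : ℤ) - H' * η)‖)]
            _ = (∑ ξ ∈ range H, ‖dft H x₂ ξ‖ ^ 2 +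
                  ∑ ξ ∈ range H, ‖dft H x₁ (-(ξ : ℤ) - H' * η)‖ ^ 2) / 2 := by
                rw [← sum_add_distrib, sum_div]
            _ ≤ (1 + 1) / 2 := by
                gcongr
                · exact sum_norm_sq_dft_comp_le_one hH hx₂ (fun ξ => (ξ : ℤ)) (crs_id hH)
                · have := sum_norm_sq_dft_comp_le_one hH hx₁ (fun ξ => -(ξ : ℤ) - H' * η)
                    (crs_neg_sub hH (H' * η))
                  exact_mod_cast this
            _ = 1 := by norm_num
      _ = τ * a := by simp
  -- on the large frequencies
  have h3 : ∑ ξ ∈ L, ∑ η ∈ range a, ‖g ξ η‖ ≤ a * s * ∑ ξ ∈ L, ‖dft H x₂ ξ‖ := by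
    calc ∑ ξ ∈ L, ∑ η ∈ range a, ‖g ξ η‖
        ≤ ∑ ξ ∈ L, ∑ η ∈ range a, ‖dft H x₂ ξ‖ * s := by
          refine sum_le_sum fun ξ _ => sum_le_sum fun η _ => ?_
          rw [hg]
          simp only [norm_mul]
          calc ‖dft H x₂ ξ‖ * ‖dft H x₁ (-(ξ : ℤ) - H' * η)‖ * ‖S ξ η‖
              ≤ ‖dft H x₂ ξ‖ * 1 * s := by
                gcongr
                · exact norm_dft_le hH hx₁ _
                · exact norm_primeExpSum_le P _
            _ = ‖dft H x₂ ξ‖ * s := by ring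
      _ = a * s * ∑ ξ ∈ L, ‖dft H x₂ ξ‖ := by
          rw [mul_sum]
          refine sum_congr rfl fun ξ _ => ?_
          rw [sum_const, card_range, nsmul_eq_mul]
          ring
  calc (H / a : ℝ) * ‖∑ ξ ∈ range H, ∑ η ∈ range a, g ξ η‖
      ≤ (H / a) * (τ * a + a * s * ∑ ξ ∈ L, ‖dft H x₂ ξ‖) := by
        gcongr
        exact h1.trans (add_le_add h2 h3)
    _ = τ * H + H * s * ∑ ξ ∈ L, ‖dft H x₂ ξ‖ := by
        field_simp

/-- **Tao 2016, Lemma 3.6 (circle method estimate), Liouville case `c_p = 1`, explicit form.**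
For `a ∣ H`, `|x₁|, |x₂| ≤ 1` on `[1, H]` and a threshold `τ ≥ 0`:
`|∑_{p ∈ 𝒫} (1/p) ∑_{j, j+ph ∈ [1,H], j ≡ pb (a)} x₁(j) x₂(j + ph)|
   ≤ |h| #𝒫 + τ H + H (∑_{p ∈ 𝒫} 1/p) ∑_{ξ ∈ Ξ} |(1/H) ∑_{j=1}^H x₂(j) e(-jξ/H)|`,
where `Ξ` is the set of `ξ ∈ ℤ/Hℤ` with `|S(hξ/H - bη/a)| ≥ τ` for some `η ∈ ℤ/aℤ`. In the paper
`τ = ε²/log H`, `𝒫 = 𝒫_H` (so `#𝒫, ∑ 1/p ≪ H/log H, 1/log H`), giving (3.17).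
[cite: TaoFMP2016, §3 Lemma 3.6] -/
theorem norm_bilin_le {H a : ℕ} (hH : 0 < H) (ha : 0 < a) (haH : a ∣ H) (b h : ℤ)
    (P : Finset ℕ) (hP : ∀ p ∈ P, 0 < p) {x₁ x₂ : ℤ → ℂ}
    (hx₁ : ∀ j ∈ Icc (1 : ℤ) H, ‖x₁ j‖ ≤ 1) (hx₂ : ∀ j ∈ Icc (1 : ℤ) H, ‖x₂ j‖ ≤ 1)
    {τ : ℝ} (hτ : 0 ≤ τ) :
    ‖bilin H a b h P x₁ x₂‖ ≤ |h| * #P + τ * H +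
      H * (∑ p ∈ P, (1 / p : ℝ)) * ∑ ξ ∈ largeFreq H a b h P τ, ‖dft H x₂ ξ‖ := by
  obtain ⟨H', hHa⟩ := haH
  have h1 := norm_bilin_sub_bilinPer_le (a := a) hH b h P hP hx₁ hx₂
  have h2 := norm_bilinPer_le hH ha hHa b h P hx₁ hx₂ hτ
  have h3 : ‖bilin H a b h P x₁ x₂‖ ≤
      ‖bilin H a b h P x₁ x₂ - bilinPer H a b h P x₁ x₂‖ + ‖bilinPer H a b h P x₁ x₂‖ := by
    have := norm_add_le (bilin H a b h P x₁ x₂ - bilinPer H a b h P x₁ x₂)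
      (bilinPer H a b h P x₁ x₂)
    rwa [sub_add_cancel] at this
  linarith

/-! ### Large values of the prime exponential sum (towards Tao 2016, Lemma 3.7) -/

/-- The additive quadruples of `𝒫`: `((p₁, p₃), (p₂, p₄))` with `p₁ + p₂ = p₃ + p₄`
(the quantity in the footnote to the proof of Tao 2016, Lemma 3.7).
[cite: TaoFMP2016, §3 (footnote to the proof of Lemma 3.7)] -/
def addQuadruples (P : Finset ℕ) : Finset ((ℕ × ℕ) × (ℕ × ℕ)) :=
  ((P ×ˢ P) ×ˢ (P ×ˢ P)).filter fun q => q.1.1 + q.2.1 = q.1.2 + q.2.2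

/-- `|S(θ)|²` as a double sum: `|S(θ)|² = ∑_{p, p'} e(θ (p - p')) / (p p')`. [folklore] -/
theorem norm_primeExpSum_sq (P : Finset ℕ) (θ : ℝ) :
    ((‖primeExpSum P θ‖ : ℂ)) ^ 2 =
      ∑ q ∈ P ×ˢ P, (1 / ((q.1 : ℂ) * q.2)) * e (θ * (((q.1 : ℤ) - q.2 : ℤ) : ℝ)) := by
  have h1 : ((‖primeExpSum P θ‖ : ℂ)) ^ 2 =
      primeExpSum P θ * (starRingEnd ℂ) (primeExpSum P θ) := by
    rw [Complex.mul_conj, Complex.normSq_eq_norm_sq]; push_cast; ring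
  rw [h1, primeExpSum, map_sum, sum_mul_sum, ← sum_product']
  refine sum_congr rfl fun q _ => ?_
  rw [map_mul, map_div₀, map_one, Complex.conj_natCast, ← e_neg, mul_mul_mul_comm, ← e_add]
  congr 1
  · field_simp
  · congr 1
    push_cast
    ring

/-- Fourth power of `|S(θ)|` as a sum over pairs of pairs `q = ((p₁, p₃), (p₂, p₄))`:
`|S(θ)|⁴ = ∑ e(θ (p₁ - p₃ + p₂ - p₄)) / (p₁ p₃ p₂ p₄)`. [folklore] -/
theorem norm_primeExpSum_pow_four (P : Finset ℕ) (θ : ℝ) :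
    ((‖primeExpSum P θ‖ : ℂ)) ^ 4 = ∑ q ∈ (P ×ˢ P) ×ˢ (P ×ˢ P),
      (1 / ((q.1.1 : ℂ) * q.1.2 * q.2.1 * q.2.2)) *
        e (θ * (((q.1.1 : ℤ) - q.1.2 + q.2.1 - q.2.2 : ℤ) : ℝ)) := by
  have h4 : ((‖primeExpSum P θ‖ : ℂ)) ^ 4 =
      ((‖primeExpSum P θ‖ : ℂ)) ^ 2 * ((‖primeExpSum P θ‖ : ℂ)) ^ 2 := by ring
  rw [h4, norm_primeExpSum_sq, sum_mul_sum, ← sum_product']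
  refine sum_congr rfl fun q _ => ?_
  rw [mul_mul_mul_comm, ← e_add]
  congr 1
  · field_simp
  · congr 1
    push_cast
    ring

/-- **Few large frequencies via the fourth moment** (the first half of the proof of Tao 2016,
Lemma 3.7, with the restriction estimate replaced by a count of additive quadruples, as in the
footnote there): if `a ∣ H`, `𝒫 ⊆ [p_min, p_max]` with `2 |h| p_max < H`, and `τ > 0`, then
`#Ξ ≤ a H τ⁻⁴ p_min⁻⁴ · #{(p₁,p₂,p₃,p₄) ∈ 𝒫⁴ : p₁ + p₂ = p₃ + p₄}`.
Proof: `1_{|S| ≥ τ} ≤ |S|⁴/τ⁴`, expand `|S|⁴`, and sum over `ξ` using orthogonality; only the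
quadruples with `h(p₁ + p₂ - p₃ - p₄) ≡ 0 (H)`, i.e. `p₁ + p₂ = p₃ + p₄`, survive.
[cite: TaoFMP2016, §3 Lemma 3.7 (proof and footnote)] -/
theorem card_largeFreq_le {H a : ℕ} (hH : 0 < H) (ha : 0 < a) (haH : a ∣ H) (b h : ℤ)
    (hh : h ≠ 0) (P : Finset ℕ) {pmin pmax : ℕ} (hpmin : 0 < pmin)
    (hP : ∀ p ∈ P, pmin ≤ p ∧ p ≤ pmax) (hsmall : 2 * |h| * pmax < H) {τ : ℝ} (hτ : 0 < τ) :
    (#(largeFreq H a b h P τ) : ℝ) ≤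
      a * H * (τ⁻¹) ^ 4 * ((pmin : ℝ)⁻¹) ^ 4 * #(addQuadruples P) := by
  obtain ⟨H', hHa⟩ := haH
  have hH0 : (0 : ℝ) < H := by exact_mod_cast hH
  have hHr : (H : ℝ) ≠ 0 := hH0.ne'
  have har : (a : ℝ) ≠ 0 := by exact_mod_cast ha.ne'
  have hpmin0 : (0 : ℝ) < pmin := by exact_mod_cast hpmin
  have hHa' : (H : ℝ) = a * H' := by exact_mod_cast hHa
  have hH'r : (H' : ℝ) ≠ 0 := by
    rintro h0; rw [h0, mul_zero] at hHa'; exact hHr hHa'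
  set S := fun ξ η : ℕ => primeExpSum P (h * ξ / H - b * η / a) with hS
  -- Step 1: `#Ξ ≤ τ⁻⁴ ∑_{ξ < H} ∑_η |S|⁴`
  have step1 : (#(largeFreq H a b h P τ) : ℝ) ≤
      (τ⁻¹) ^ 4 * ∑ ξ ∈ range H, ∑ η ∈ range a, ‖S ξ η‖ ^ 4 := by
    have h1 : (#(largeFreq H a b h P τ) : ℝ) = ∑ ξ ∈ largeFreq H a b h P τ, (1 : ℝ) := by simp
    rw [h1, mul_sum, ← sum_sdiff (largeFreq_subset H a b h P τ)]
    have hnn : 0 ≤ ∑ ξ ∈ range H \ largeFreq H a b h P τ,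
        (τ⁻¹) ^ 4 * ∑ η ∈ range a, ‖S ξ η‖ ^ 4 :=
      sum_nonneg fun ξ _ => mul_nonneg (by positivity) (sum_nonneg fun η _ => by positivity)
    refine le_add_of_nonneg_of_le hnn (sum_le_sum fun ξ hξ => ?_)
    obtain ⟨_, η, hη, hle⟩ := mem_largeFreq.1 hξ
    rw [mul_sum]
    calc (1 : ℝ) ≤ (τ⁻¹) ^ 4 * ‖S ξ η‖ ^ 4 := by
          rw [show (τ⁻¹) ^ 4 * ‖S ξ η‖ ^ 4 = (‖S ξ η‖ / τ) ^ 4 by ring]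
          exact one_le_pow₀ ((one_le_div hτ).2 hle)
      _ ≤ ∑ η' ∈ range a, (τ⁻¹) ^ 4 * ‖S ξ η'‖ ^ 4 :=
          single_le_sum (f := fun η' => (τ⁻¹) ^ 4 * ‖S ξ η'‖ ^ 4)
            (fun η' _ => by positivity) hη
  -- Step 2: for each `η`, `∑_{ξ < H} |S|⁴ ≤ H p_min⁻⁴ #quadruples`
  have step2 : ∀ η ∈ range a, ∑ ξ ∈ range H, ‖S ξ η‖ ^ 4 ≤
      H * ((pmin : ℝ)⁻¹) ^ 4 * #(addQuadruples P) := by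
    intro η _
    set c : ℤ := b * H' * η with hc
    set M : (ℕ × ℕ) × (ℕ × ℕ) → ℤ := fun q => (q.1.1 : ℤ) - q.1.2 + q.2.1 - q.2.2 with hM
    set w : (ℕ × ℕ) × (ℕ × ℕ) → ℂ := fun q => 1 / ((q.1.1 : ℂ) * q.1.2 * q.2.1 * q.2.2) with hw
    -- expand `|S|⁴` and separate the `ξ`-dependence of the phase
    have e1 : ∀ ξ ∈ range H, ((‖S ξ η‖ : ℂ)) ^ 4 = ∑ q ∈ (P ×ˢ P) ×ˢ (P ×ˢ P),
        w q * (e (-(c * M q) / H) * e ((h * M q : ℤ) * (ξ : ℕ) / H)) := by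
      intro ξ _
      rw [hS]
      simp only
      rw [norm_primeExpSum_pow_four]
      refine sum_congr rfl fun q _ => ?_
      rw [← e_add]
      congr 1
      rw [hM, hc]
      push_cast
      rw [hHa']
      field_simp
      ring
    -- sum over `ξ` using orthogonality
    have e2 : ∀ q ∈ (P ×ˢ P) ×ˢ (P ×ˢ P),
        ∑ ξ ∈ range H, w q * (e (-(c * M q) / H) * e ((h * M q : ℤ) * (ξ : ℕ) / H)) =
          if q.1.1 + q.2.1 = q.1.2 + q.2.2 then (H : ℂ) * w q else 0 := by
      intro q hq
      rw [← mul_sum, ← mul_sum, sum_e_mul_div _ hH]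
      simp only [mem_product] at hq
      obtain ⟨⟨h11, h12⟩, h21, h22⟩ := hq
      by_cases hm : q.1.1 + q.2.1 = q.1.2 + q.2.2
      · have hm0 : M q = 0 := by
          have : ((q.1.1 + q.2.1 : ℕ) : ℤ) = ((q.1.2 + q.2.2 : ℕ) : ℤ) := by rw [hm]
          push_cast at this
          rw [hM]
          simp only
          linarith
        rw [if_pos hm, hm0, if_pos (by simp)]
        simp [e_zero]
        ring
      · rw [if_neg hm, if_neg]
        · simp
        · -- `H ∤ h M` since `0 < |h M| < H`
          intro hdiv
          have hm0 : M q ≠ 0 := by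
            intro h0
            apply hm
            rw [hM] at h0
            simp only at h0
            have : ((q.1.1 + q.2.1 : ℕ) : ℤ) = ((q.1.2 + q.2.2 : ℕ) : ℤ) := by
              push_cast; linarith
            exact_mod_cast this
          have hb1 := hP _ h11
          have hb2 := hP _ h12
          have hb3 := hP _ h21
          have hb4 := hP _ h22
          have hmabs : |M q| < 2 * pmax := by
            rw [hM, abs_lt]
            simp only
            constructor <;> omega
          obtain ⟨k, hk⟩ := hdiv
          have hk0 : k ≠ 0 := by
            rintro rfl
            rw [mul_zero, mul_eq_zero] at hk
            exact hk.elim hh hm0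
          have h1 : |h * M q| < H := by
            rw [abs_mul]
            calc |h| * |M q| ≤ |h| * (2 * pmax) := by gcongr
              _ = 2 * |h| * pmax := by ring
              _ < H := hsmall
          rw [hk, abs_mul, Nat.abs_cast] at h1
          have : (1 : ℤ) ≤ |k| := Int.one_le_abs hk0
          have hH1 : (0 : ℤ) < H := by exact_mod_cast hH
          nlinarith
    have key : (((∑ ξ ∈ range H, ‖S ξ η‖ ^ 4 : ℝ)) : ℂ) =
        ((∑ q ∈ addQuadruples P, (H : ℝ) * (1 / ((q.1.1 : ℝ) * q.1.2 * q.2.1 * q.2.2)) : ℝ) : ℂ) := by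
      push_cast
      rw [sum_congr rfl e1, sum_comm, sum_congr rfl e2, ← sum_filter]
      rfl
    have key' := Complex.ofReal_injective key
    rw [key']
    calc ∑ q ∈ addQuadruples P, (H : ℝ) * (1 / ((q.1.1 : ℝ) * q.1.2 * q.2.1 * q.2.2))
        ≤ ∑ q ∈ addQuadruples P, (H : ℝ) * ((pmin : ℝ)⁻¹) ^ 4 := by
          refine sum_le_sum fun q hq => ?_
          unfold addQuadruples at hq
          simp only [mem_filter, mem_product] at hq
          obtain ⟨⟨⟨h11, h12⟩, h21, h22⟩, _⟩ := hq
          have hb1 : (pmin : ℝ) ≤ q.1.1 := by exact_mod_cast (hP _ h11).1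
          have hb2 : (pmin : ℝ) ≤ q.1.2 := by exact_mod_cast (hP _ h12).1
          have hb3 : (pmin : ℝ) ≤ q.2.1 := by exact_mod_cast (hP _ h21).1
          have hb4 : (pmin : ℝ) ≤ q.2.2 := by exact_mod_cast (hP _ h22).1
          gcongr
          rw [inv_pow, one_div]
          apply inv_anti₀ (by positivity)
          calc (pmin : ℝ) ^ 4 = pmin * pmin * pmin * pmin := by ring
            _ ≤ q.1.1 * q.1.2 * q.2.1 * q.2.2 := by gcongr
      _ = H * ((pmin : ℝ)⁻¹) ^ 4 * #(addQuadruples P) := by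
          rw [sum_const, nsmul_eq_mul]; ring
  -- combine
  calc (#(largeFreq H a b h P τ) : ℝ)
      ≤ (τ⁻¹) ^ 4 * ∑ ξ ∈ range H, ∑ η ∈ range a, ‖S ξ η‖ ^ 4 := step1
    _ = (τ⁻¹) ^ 4 * ∑ η ∈ range a, ∑ ξ ∈ range H, ‖S ξ η‖ ^ 4 := by rw [sum_comm]
    _ ≤ (τ⁻¹) ^ 4 * ∑ η ∈ range a, (H * ((pmin : ℝ)⁻¹) ^ 4 * #(addQuadruples P)) := by
        gcongr with η hη
        exact step2 η hη
    _ = a * H * (τ⁻¹) ^ 4 * ((pmin : ℝ)⁻¹) ^ 4 * #(addQuadruples P) := by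
        rw [sum_const, card_range, nsmul_eq_mul]; ring

end Tao2016

end Literature.NumberTheory.LFunctions

end
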